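import Literature.AnabelianGeometry.EtaleTheta.Discharge.Sec3Thm37ivEndKnit
import Literature.AnabelianGeometry.EtaleTheta.Discharge.Sec3BZeroInjectiveOfTower
import Literature.AnabelianGeometry.EtaleTheta.TemperedFrobenioidOfKummerTateTower
import Literature.AnabelianGeometry.EtaleTheta.TemperedFrobenioidOfGaloisCoveringTateTower
import Literature.AnabelianGeometry.EtaleTheta.TemperedFrobenioidOfGaloisCoveringZTower
import Literature.AlgebraicGeometry.Frobenioids.ArchimedeanPointBaseThm36
import HarnessLib

/-!
# [EtTh] Theorem 3.7 (iv) «`D` slim, `Λ ∈ {ℤ, ℝ}` ⟹ `C` slim», `Λ = ℤ` — END KNIT AT THE MODELS OF RECORD: the node AS TYPED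
# (`TemperedFrobenioid.Thm37_iv`) with NO binder at the Tate tower (v1), the Kummer–Tate tower (v2), the ℤ-tower and the
# one-component model over `B^temp(Π^tp_X)⁰`, and for EVERY v2 tower `DivisorMonoids.ofTower T` (proof-only)

S. Mochizuki, *The étale theta function and its Frobenioid-theoretic manifestations*, Publ. RIMS **45** (2009)
[MochizukiEtTh2009], §3: Thm. 3.7 (iv), printed p. 306 (PDF p. 80) l. 7, proof ll. 23–25; Prop. 3.2 (iii) PDF p. 70 («`g_N^N = f`
for all `N ≥ 1` ⟹ `f = 1`»); Def. 3.3 (iii) PDF p. 73. [MochizukiFrdI2008] Prop. 1.13 (iii) p. 31, Thm. 5.2 (ii) p. 100.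
[cite: MochizukiEtTh2009, Thm 3.7 (iv) p.80] [cite: MochizukiEtTh2009, Prop 3.2 (iii) p.70]

abc-iut cell, layer L2, cone node **`EtTh:Thm3.7(iv)`** (`N_EtTh_Thm3_7_iv`), seat abc-iut-w5-d246 (gen 8); sequel of
`Sec3Thm37ivEndKnit.lean` (p488193: `hdiv_of_BΛ_eq_one_of_divisible`, `bZero_eq_one_of_forall_exists_pow_eq`, and `Thm37_iv` with
NO binder at the genuine connected data `DivisorMonoids.ofGaloisActionConnected`).  PROOF-ONLY (0 `def`s, no `Prop` facts, no
instances); everything landed is consumed BY NAME.  Here the SAME Prop. 3.2 (iii) route is run at the other Def. 3.3 (iii)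
records of the tree — all of whose `B₀(Y)` are groups of equivariant log-meromorphic functions `Hom_Π(S, Mero(Z_∞))`
(abc-iut-w6-d058's `bZero`), at one `Z_∞` or at the `Δ^fil`-closure level of `Y` (abc-iut-L2-t3's `LogDivisorTower`):
* §1 «`B₀(Y)` has no non-trivial infinitely divisible element» for `ofGaloisAction` (all `Π`-sets), `ofGaloisActionTempered`
  (`B^temp(Π)⁰`), `ofGaloisActionCosetCat` (`CosetCat Π`), `ofTower T` (v2, covering-indexed `Mero`) — one-liners over
  `bZero_eq_one_of_forall_exists_pow_eq`;
* §2 `Thm37_iv` for every tempered Frobenioid of monoid type `ℤ` over the weak constructed data `ofRlfZWeak` of those records,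
  ANY base ⟸ `hF` only; for v2 towers re-based to `B^temp(Π′)⁰`: **NO binder** (abc-iut-L2-d2's
  `isFrobenioid_ofTower_connectedPart`), «`C` slim» ⟸ {`Π′` tempered, temp-slim};
* §3 **the MODELS OF RECORD, `Λ = ℤ`, `Thm37_iv` with NO binder and «`C` slim» OUTRIGHT**: `TateTowerFrd.temperedFrobenioid`
  (v1 Tate tower, base `pt`), `TateTowerKummer.temperedFrobenioid` (v2 Kummer–Tate tower, base `pt`), every rank-one object of a
  v2 tower / of connected Galois data (abc-iut-w5-d179's `ofRankOneObject`; base `Discrete PUnit` is slim, L1's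
  `isSlim_discretePUnit`), `ZTowerTempered.temperedFrobenioid` (the multi-prime ℤ-tower over `B^temp(Π^tp_X)⁰`) and
  `OneCompTempered.temperedFrobenioid` (one special-fibre component over `B^temp(Π^tp_X)⁰`) — the last two «`C` slim»
  UNCONDITIONALLY by [SemiAnbd] Ex. 3.10 (`TemperedArithmeticGroup.isSlim_connectedPart`).
Before this file the tree's `Λ = ℤ` instances of `Thm37_iv` were the abstract / genuine-connected closers (p488193) and the torsion
TOY (`Sec3Thm37TorsionToy`), none at a model of record; (iv) at the `Λ = ℝ` models (p448135, p453493) is untouched.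

HONEST FRAMING: refereed pre-IUT material; instantiation / consistency certificates at CONSTRUCTED data (parameter records,
nothing asserts they arise from an actual curve); nothing here bears on the disputed [IUTchIII] Cor. 3.12; typed ≠ proved —
here PROVED.
-/

noncomputable section

namespace Literature.AnabelianGeometry.EtaleTheta

open CategoryTheory Opposite Function Literature.AlgebraicGeometry.Frobenioids Literature.AnabelianGeometry.SemiGraphs
  LogDivisorModel.GaloisAction LogDivisorTower

universe u u' v'

/-! ### §1 Prop. 3.2 (iii) at the other Def. 3.3 (iii) records: `B₀(Y)` has no non-trivial infinitely divisible element -/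

namespace DivisorMonoids

/-- `ofGaloisAction` (all `Π`-sets): Prop. 3.2 (iii) for `B₀(S) = Hom_Π(S, Mero(Z_∞))`. [cite: MochizukiEtTh2009, Prop 3.2 (iii) p.70] -/
theorem ofGaloisAction_B₀_eq_one_of_forall_exists_pow_eq {Z : LogDivisorModel.{u}} {G : Type u} [Group G]
    (A : Z.GaloisAction G) (hZ : Z.CuspLaws) (S : (Action (Type u) G)ᵒᵖ) (b : (ofGaloisAction A hZ).B₀.obj S)
    (h : ∀ N : ℕ+, ∃ c : (ofGaloisAction A hZ).B₀.obj S, c ^ (N : ℕ) = b) : b = 1 :=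
  A.bZero_eq_one_of_forall_exists_pow_eq S.unop b h

/-- `ofGaloisActionTempered` (base change to `B^temp(Π)⁰`): Prop. 3.2 (iii) for `B₀(Y)`. [cite: MochizukiEtTh2009, Prop 3.2 (iii) p.70] -/
theorem ofGaloisActionTempered_B₀_eq_one_of_forall_exists_pow_eq {Γ : Type u} [Group Γ] [TopologicalSpace Γ]
    {Z : LogDivisorModel.{u}} (A : Z.GaloisAction Γ) (hZ : Z.CuspLaws) (Y : (ConnectedPart (BTemp Γ))ᵒᵖ)
    (b : (ofGaloisActionTempered A hZ).B₀.obj Y)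
    (h : ∀ N : ℕ+, ∃ c : (ofGaloisActionTempered A hZ).B₀.obj Y, c ^ (N : ℕ) = b) : b = 1 :=
  A.bZero_eq_one_of_forall_exists_pow_eq Y.unop.obj.obj b h

/-- `ofGaloisActionCosetCat` (the small model `CosetCat Π`): Prop. 3.2 (iii) for `B₀(H)`. [cite: MochizukiEtTh2009, Prop 3.2 (iii) p.70] -/
theorem ofGaloisActionCosetCat_B₀_eq_one_of_forall_exists_pow_eq {Γ : Type u} [Group Γ] [TopologicalSpace Γ]
    [IsTopologicalGroup Γ] (hΓ : IsTempered Γ) {Z : LogDivisorModel.{u}} (A : Z.GaloisAction Γ) (hZ : Z.CuspLaws)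
    (Y : (CosetCat Γ)ᵒᵖ) (b : (ofGaloisActionCosetCat hΓ A hZ).B₀.obj Y)
    (h : ∀ N : ℕ+, ∃ c : (ofGaloisActionCosetCat hΓ A hZ).B₀.obj Y, c ^ (N : ℕ) = b) : b = 1 :=
  A.bZero_eq_one_of_forall_exists_pow_eq ((CosetCat.toBTemp hΓ).obj Y.unop).obj b h

/-- `ofTower T` (v2, covering-indexed `Mero`: `B₀(Y) = Hom_Π(Y, Mero(Z_∞^{(lvl Y)}))`): Prop. 3.2 (iii) AT THE LEVEL of `Y`.
[cite: MochizukiEtTh2009, Prop 3.2 (iii) p.70] -/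
theorem ofTower_B₀_eq_one_of_forall_exists_pow_eq {P : Type u} [Group P] [TopologicalSpace P] {L : LevelSystem P}
    (T : LogDivisorTower P L) (Y : (ConnectedPart (BTemp P))ᵒᵖ) (b : (ofTower T).B₀.obj Y)
    (h : ∀ N : ℕ+, ∃ c : (ofTower T).B₀.obj Y, c ^ (N : ℕ) = b) : b = 1 :=
  (T.act (L.lvl Y.unop)).bZero_eq_one_of_forall_exists_pow_eq (gset Y.unop) b h

end DivisorMonoids

/-! ### §2 `Thm37_iv`, monoid type `ℤ`, weak constructed data of these records -/

namespace TemperedFrobenioid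

section CosetCatAnyBase

variable {Γ : Type u} [Group Γ] [TopologicalSpace Γ] [IsTopologicalGroup Γ] (hΓ : IsTempered Γ)
  {Z : LogDivisorModel.{u}} (A : Z.GaloisAction Γ) (hZ : Z.CuspLaws)
  (hpf : ∀ Y : (CosetCat Γ)ᵒᵖ, IsPerfFactorialCof ((DivisorMonoids.ofGaloisActionCosetCat hΓ A hZ).Φ₀.obj Y))
  {D : Type u'} [Category.{v'} D] {VD : FrdICatStub.{u', v', u} D}
  (C₁ : TemperedFrobenioid (RealifiedDivisorMonoids.ofRlfZWeak (DivisorMonoids.ofGaloisActionCosetCat hΓ A hZ) hpf) D VD)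

/-- **[EtTh] Thm. 3.7 (iv) AS TYPED, monoid type `ℤ`, weak constructed data of the small model `CosetCat Π`, ANY base, ANY
vocabulary ⟸ `hF` ONLY.** [cite: MochizukiEtTh2009, Thm 3.7 (iv) p.80] -/
theorem thm37_iv_ofRlfZWeak_ofGaloisActionCosetCat (hF : PreFrobenioid.IsFrobenioid C₁.toElem) :
    Literature.AnabelianGeometry.EtaleTheta.TemperedFrobenioid.Thm37_iv
      (T := RealifiedDivisorMonoids.ofRlfZWeak (DivisorMonoids.ofGaloisActionCosetCat hΓ A hZ) hpf) C₁ :=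
  C₁.thm37_iv_of_BΛ_eq_one_of_divisible hF fun B b h =>
    DivisorMonoids.ofGaloisActionCosetCat_B₀_eq_one_of_forall_exists_pow_eq hΓ A hZ (C₁.baseOp B) b h

end CosetCatAnyBase

section TowerAnyBase

variable {P : Type u} [Group P] [TopologicalSpace P] {L : LevelSystem P} (T : LogDivisorTower P L)
  (hpf : ∀ Y : (ConnectedPart (BTemp P))ᵒᵖ, IsPerfFactorialCof ((DivisorMonoids.ofTower T).Φ₀.obj Y))
  {D : Type u'} [Category.{v'} D] {VD : FrdICatStub.{u', v', u} D}
  (C₁ : TemperedFrobenioid (RealifiedDivisorMonoids.ofRlfZWeak (DivisorMonoids.ofTower T) hpf) D VD)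

/-- **[EtTh] Thm. 3.7 (iv) AS TYPED, monoid type `ℤ`, weak constructed data of a v2 tower, ANY base, ANY vocabulary ⟸ `hF` ONLY.**
[cite: MochizukiEtTh2009, Thm 3.7 (iv) p.80] -/
theorem thm37_iv_ofRlfZWeak_ofTower (hF : PreFrobenioid.IsFrobenioid C₁.toElem) :
    Literature.AnabelianGeometry.EtaleTheta.TemperedFrobenioid.Thm37_iv
      (T := RealifiedDivisorMonoids.ofRlfZWeak (DivisorMonoids.ofTower T) hpf) C₁ :=
  C₁.thm37_iv_of_BΛ_eq_one_of_divisible hF fun B b h =>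
    DivisorMonoids.ofTower_B₀_eq_one_of_forall_exists_pow_eq T (C₁.baseOp B) b h

end TowerAnyBase

section TowerGenuineBase

variable {P : Type u} [Group P] [TopologicalSpace P] {L : LevelSystem P} (T : LogDivisorTower P L)
  (hpf : ∀ Y : (ConnectedPart (BTemp P))ᵒᵖ, IsPerfFactorialCof ((DivisorMonoids.ofTower T).Φ₀.obj Y))
  {G : Type u} [Group G] [TopologicalSpace G]
  {IsRational IsStrictlyRational : ((ConnectedPart (BTemp G))ᵒᵖ ⥤ CommMonCat.{u}) → Prop}
  (C₀ : TemperedFrobenioid (RealifiedDivisorMonoids.ofRlfZWeak (DivisorMonoids.ofTower T) hpf) (ConnectedPart (BTemp G))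
    (treeCatVocab (ConnectedPart (BTemp G)) IsRational IsStrictlyRational))

/-- **[EtTh] Thm. 3.7 (iv) AS TYPED with NO binder** for every tempered Frobenioid of monoid type `ℤ` over the weak data of a
v2 tower `ofTower T`, re-based to a genuine base `B^temp(Π′)⁰` («`C` Frobenioid» := abc-iut-L2-d2's unconditional
`isFrobenioid_ofTower_connectedPart`). [cite: MochizukiEtTh2009, Thm 3.7 (iv) p.80] -/
theorem thm37_iv_ofTower_connectedPart :
    Literature.AnabelianGeometry.EtaleTheta.TemperedFrobenioid.Thm37_iv
      (T := RealifiedDivisorMonoids.ofRlfZWeak (DivisorMonoids.ofTower T) hpf) C₀ :=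
  thm37_iv_ofRlfZWeak_ofTower T hpf C₀ (isFrobenioid_ofTower_connectedPart T hpf C₀)

/-- **«`C` is slim» ⇐ {`Π′` tempered, `Π′` temp-slim}** for those Frobenioids. [cite: MochizukiEtTh2009, Thm 3.7 (iv) p.80] -/
theorem isSlim_category_ofTower_connectedPart [IsTopologicalGroup G] (hG : IsTempered G) (hS : IsSlimGroup G) :
    IsSlim C₀.category :=
  thm37_iv_ofTower_connectedPart T hpf C₀ (isSlim_connectedPart_bTemp hG hS) (Or.inl rfl)

end TowerGenuineBase

/-! ### §3 The models of record, monoid type `ℤ`: `Thm37_iv` with NO binder, «`C` slim» outright -/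

section RankOneObjects

variable (R S : ((Discrete PUnit.{1})ᵒᵖ ⥤ CommMonCat.{0}) → Prop)

/-- **Every rank-one object of a v2 tower** (abc-iut-w5-d179's `ofRankOneObject`; base `pt ↦ Y₀`): `Thm37_iv` with NO binder.
[cite: MochizukiEtTh2009, Thm 3.7 (iv) p.80] -/
theorem thm37_iv_ofRankOneObject_ofTower {P : Type} [Group P] [TopologicalSpace P] {L : LevelSystem P}
    (T : LogDivisorTower P L) (Q : (DivisorMonoids.ofTower T).RankOneObject)
    (hpf : ∀ Y : (ConnectedPart (BTemp P))ᵒᵖ, IsPerfFactorialCof ((DivisorMonoids.ofTower T).Φ₀.obj Y)) :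
    Literature.AnabelianGeometry.EtaleTheta.TemperedFrobenioid.Thm37_iv
      (T := RealifiedDivisorMonoids.ofRlfZWeak (DivisorMonoids.ofTower T) hpf) (ofRankOneObject Q hpf R S) :=
  thm37_iv_ofRlfZWeak_ofTower T hpf _ (isFrobenioid_ofRankOneObject Q hpf R S)

/-- … and «`C` is slim» OUTRIGHT there (the base `Discrete PUnit` is slim, L1's `isSlim_discretePUnit`).
[cite: MochizukiEtTh2009, Thm 3.7 (iv) p.80] -/
theorem isSlim_category_ofRankOneObject_ofTower {P : Type} [Group P] [TopologicalSpace P] {L : LevelSystem P}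
    (T : LogDivisorTower P L) (Q : (DivisorMonoids.ofTower T).RankOneObject)
    (hpf : ∀ Y : (ConnectedPart (BTemp P))ᵒᵖ, IsPerfFactorialCof ((DivisorMonoids.ofTower T).Φ₀.obj Y)) :
    IsSlim (ofRankOneObject Q hpf R S).category :=
  thm37_iv_ofRankOneObject_ofTower R S T Q hpf isSlim_discretePUnit (Or.inl rfl)

/-- **Every rank-one object of connected Galois data** `ofGaloisActionConnected A hZ`: `Thm37_iv` with NO binder.
[cite: MochizukiEtTh2009, Thm 3.7 (iv) p.80] -/
theorem thm37_iv_ofRankOneObject_ofGaloisActionConnected {Z : LogDivisorModel.{0}} {G : Type} [Group G]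
    (A : Z.GaloisAction G) (hZ : Z.CuspLaws) (Q : (DivisorMonoids.ofGaloisActionConnected A hZ).RankOneObject)
    (hpf : ∀ Y : ((isConnectedGSet (G := G)).FullSubcategory)ᵒᵖ,
      IsPerfFactorialCof ((DivisorMonoids.ofGaloisActionConnected A hZ).Φ₀.obj Y)) :
    Literature.AnabelianGeometry.EtaleTheta.TemperedFrobenioid.Thm37_iv
      (T := RealifiedDivisorMonoids.ofRlfZWeak (DivisorMonoids.ofGaloisActionConnected A hZ) hpf) (ofRankOneObject Q hpf R S) :=
  thm37_iv_ofRlfZWeak_ofGaloisActionConnected A hZ hpf _ (isFrobenioid_ofRankOneObject Q hpf R S)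

/-- … and «`C` is slim» OUTRIGHT there. [cite: MochizukiEtTh2009, Thm 3.7 (iv) p.80] -/
theorem isSlim_category_ofRankOneObject_ofGaloisActionConnected {Z : LogDivisorModel.{0}} {G : Type} [Group G]
    (A : Z.GaloisAction G) (hZ : Z.CuspLaws) (Q : (DivisorMonoids.ofGaloisActionConnected A hZ).RankOneObject)
    (hpf : ∀ Y : ((isConnectedGSet (G := G)).FullSubcategory)ᵒᵖ,
      IsPerfFactorialCof ((DivisorMonoids.ofGaloisActionConnected A hZ).Φ₀.obj Y)) :
    IsSlim (ofRankOneObject Q hpf R S).category :=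
  thm37_iv_ofRankOneObject_ofGaloisActionConnected R S A hZ Q hpf isSlim_discretePUnit (Or.inl rfl)

end RankOneObjects

end TemperedFrobenioid

namespace TateTowerFrd

variable (R S : ((Discrete PUnit.{1})ᵒᵖ ⥤ CommMonCat.{0}) → Prop)

/-- **The v1 MODEL OF RECORD (Tate tower, base `pt ↦ G/G`): [EtTh] Thm. 3.7 (iv) AS TYPED with NO binder**
(`hF := isFrobenioid_temperedFrobenioid_byName`, abc-iut-w6-d048). [cite: MochizukiEtTh2009, Thm 3.7 (iv) p.80] -/
theorem thm37_iv_temperedFrobenioid :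
    Literature.AnabelianGeometry.EtaleTheta.TemperedFrobenioid.Thm37_iv
      (T := RealifiedDivisorMonoids.ofRlfZWeak dm hpf) (temperedFrobenioid R S) :=
  TemperedFrobenioid.thm37_iv_ofRlfZWeak_ofGaloisActionConnected _ _ hpf _ (isFrobenioid_temperedFrobenioid_byName R S)

/-- **… and «`C` is slim» OUTRIGHT at the v1 model of record.** [cite: MochizukiEtTh2009, Thm 3.7 (iv) p.80] -/
theorem isSlim_category_temperedFrobenioid : IsSlim (temperedFrobenioid R S).category :=
  thm37_iv_temperedFrobenioid R S isSlim_discretePUnit (Or.inl rfl)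

end TateTowerFrd

namespace TateTowerKummer

variable (R S : ((Discrete PUnit.{1})ᵒᵖ ⥤ CommMonCat.{0}) → Prop)

/-- **The v2 MODEL OF RECORD (Kummer–Tate tower, covering-indexed `Mero`, base `pt ↦ Grp/Grp`): [EtTh] Thm. 3.7 (iv) AS TYPED
with NO binder** (`hF := isFrobenioid_temperedFrobenioid`, abc-iut-L2-d2). [cite: MochizukiEtTh2009, Thm 3.7 (iv) p.80] -/
theorem thm37_iv_temperedFrobenioid :
    Literature.AnabelianGeometry.EtaleTheta.TemperedFrobenioid.Thm37_iv
      (T := RealifiedDivisorMonoids.ofRlfZWeak (DivisorMonoids.ofTower tower) hpf) (temperedFrobenioid R S) :=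
  TemperedFrobenioid.thm37_iv_ofRlfZWeak_ofTower tower hpf _ (isFrobenioid_temperedFrobenioid R S)

/-- **… and «`C` is slim» OUTRIGHT at the v2 model of record.** [cite: MochizukiEtTh2009, Thm 3.7 (iv) p.80] -/
theorem isSlim_category_temperedFrobenioid : IsSlim (temperedFrobenioid R S).category :=
  thm37_iv_temperedFrobenioid R S isSlim_discretePUnit (Or.inl rfl)

end TateTowerKummer

namespace ZTowerTempered

variable {K : Type} [Field K] (X : TemperedArithmeticGroup.{0} K) (φ : X.Pi →* Multiplicative ℤ)
  (R S : ((ConnectedPart (BTemp X.Pi))ᵒᵖ ⥤ CommMonCat.{0}) → Prop)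

/-- **The ℤ-TOWER model over the GENUINE base `B^temp(Π^tp_X)⁰` (first multi-prime `Λ = ℤ` model): [EtTh] Thm. 3.7 (iv) AS
TYPED with NO binder** (`hF := isFrobenioid_temperedFrobenioid`, abc-iut-w5-d179). [cite: MochizukiEtTh2009, Thm 3.7 (iv) p.80] -/
theorem thm37_iv_temperedFrobenioid :
    Literature.AnabelianGeometry.EtaleTheta.TemperedFrobenioid.Thm37_iv
      (T := RealifiedDivisorMonoids.ofRlfZWeak (dm X φ) (hpf X φ)) (temperedFrobenioid X φ R S) :=
  (temperedFrobenioid X φ R S).thm37_iv_of_BΛ_eq_one_of_divisible (isFrobenioid_temperedFrobenioid X φ R S)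
    fun B b h => DivisorMonoids.ofGaloisActionCosetCat_B₀_eq_one_of_forall_exists_pow_eq X.isTempered _ _
      ((temperedFrobenioid X φ R S).baseOp B) b h

/-- **… and «`C` is slim» UNCONDITIONALLY at the ℤ-tower model** («`D` slim» = [SemiAnbd] Ex. 3.10,
`TemperedArithmeticGroup.isSlim_connectedPart`). [cite: MochizukiEtTh2009, Thm 3.7 (iv) p.80] -/
theorem isSlim_category_temperedFrobenioid : IsSlim (temperedFrobenioid X φ R S).category :=
  thm37_iv_temperedFrobenioid X φ R S X.isSlim_connectedPart (Or.inl rfl)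

end ZTowerTempered

namespace OneCompTempered

variable (U : Type) [CommGroup U] (hU : ∀ u : U, (∀ N : ℕ+, ∃ g : U, g ^ (N : ℕ) = u) → u = 1)
  {K : Type} [Field K] (X : TemperedArithmeticGroup.{0} K)
  (R S : ((ConnectedPart (BTemp X.Pi))ᵒᵖ ⥤ CommMonCat.{0}) → Prop)

/-- **The ONE-COMPONENT model over the GENUINE base `B^temp(Π^tp_X)⁰: [EtTh] Thm. 3.7 (iv) AS TYPED with NO binder**
(`hF := isFrobenioid_temperedFrobenioid`, abc-iut-w6-d048). [cite: MochizukiEtTh2009, Thm 3.7 (iv) p.80] -/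
theorem thm37_iv_temperedFrobenioid :
    Literature.AnabelianGeometry.EtaleTheta.TemperedFrobenioid.Thm37_iv
      (T := RealifiedDivisorMonoids.ofRlfZWeak (dm U hU X) (hpf U hU X)) (temperedFrobenioid U hU X R S) :=
  (temperedFrobenioid U hU X R S).thm37_iv_of_BΛ_eq_one_of_divisible (isFrobenioid_temperedFrobenioid U hU X R S)
    fun B b h => DivisorMonoids.ofGaloisActionCosetCat_B₀_eq_one_of_forall_exists_pow_eq X.isTempered _ _
      ((temperedFrobenioid U hU X R S).baseOp B) b h

/-- **… and «`C` is slim» UNCONDITIONALLY at the one-component model.** [cite: MochizukiEtTh2009, Thm 3.7 (iv) p.80] -/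
theorem isSlim_category_temperedFrobenioid : IsSlim (temperedFrobenioid U hU X R S).category :=
  thm37_iv_temperedFrobenioid U hU X R S X.isSlim_connectedPart (Or.inl rfl)

end OneCompTempered

end Literature.AnabelianGeometry.EtaleTheta

end
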